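import Mathlib
import HarnessLib
import Summits.HubbardSuperconductivity.HubbardSuperconductivity.Theorems.KLProgrammeKLRegimeEngineScaleZeroTransfer
import Summits.HubbardSuperconductivity.HubbardSuperconductivity.Theorems.KLProgrammeKLRegimeEngineScaleZeroGridTransfer
import Summits.HubbardSuperconductivity.HubbardSuperconductivity.Theorems.KLProgrammeKLRegimeEnginePairTransferMemberDifference
import Summits.HubbardSuperconductivity.HubbardSuperconductivity.Theorems.KLProgrammeKLRegimeEnginePairTransferMemberCarrierBinomial

/-!
# Route `KLProgramme` — ENGINE child gen 8 (stmt-HubbardSuperconductivity-20437 `KLRegimeEngineV17F2`), skeleton v2 class #5 rev 3: the smearing rows IN GRID CURRENCY —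
# `klmg_effectiveActionCT_eq_map_grid`, `klmg_carrier_eq_map_grid`, `klmg_sum_norm_kernel_gaussConv_le_binomial`, **`klmg_vertexFn_map_gaussConv_le_binomial`**,
# **`klmg_vertexFn_map_gaussConv_sub_le_binomial`**, **`klmg_vertexFn_map_gaussConv_sub_le_binomial₂`**, **`klmg_isGramBoundedR_gridSub_softCovOf_of_mass_le`**
# (cell gate-hubbard-kl, seat hubbard-kl-k3c1-p1 g14, technique «composed-map remainder propagation»: `e^{Δ_D}𝒲 = map S ∘ e^{Δ_{SᵀDS}}`; cure of the located
# «(X).3-BINOMIAL-CURRENCY», HOME/STATUS k3c1-p1 g14)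

WHY.  The class-#5 smearing supplies written on MOMENTUM labels (row 28 `klmf_baseData_of_binomial`, the BASE clause of rows 30/37/37b/41/41b, rows 38/43) take
`IsGramBoundedR (softCovOf K φ) κ` and pinned momentum-label kernel sums — but `IsGramBoundedR C κ` forces `‖C X Y‖ ≤ κ²` (`IsGramBounded.norm_gaussExpect_genProd_le`,
`N = 2`) and `softCovOf K φ` has diagonal entries of norm `φ(k)·βL²/ρ_K(k)`, so `κ² ≥ βL²·sup φ/ρ_K` is EXTENSIVE, and the pinned momentum sums are volume/UV-extensive:
TRUE rows, no sizes.  The programme's sound currency (k3c2-p1 g5 `norm_klCovSmearedPairAmplitude_zero_sub_le_of_gridStep`) is the GRID one: conjugate by the grid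
substitution `S = hubbardGridSub L M β N` (`N = 4M`).  This file is the generic layer of that cure:
* `klmg_effectiveActionCT_eq_map_grid` — for EVERY real cutoff `Λ` (the continuum slice): `𝒲^K_Λ = map S (effAction (SᵀC^K_{>Λ}S) (V_N + 𝒩_{K,N}))` (`effAction_map`,
  `map_hubbardGridSub_gridInteractionCT`; `klEffectiveAction_eq_map_hubbardGridSub` is the grid-scale case); `klmg_carrier_eq_map_grid` — hence every CARRIER
  `e^{Δ_D}𝒲^K_Λ = map S (e^{Δ_{SᵀDS}}·effAction (SᵀC^K_{>Λ}S) Ṽ)` (`gaussConv_map`); `klmg_gridAction_mem_evenPart`;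
* **`klmg_vertexFn_map_gaussConv_le_binomial`** — VALUES of a smeared grid functional: `G` even on the grid with pinned kernel norms `N_g`, `IsGramBoundedR D′ γ` ⟹
  `‖𝒱_{2p}(map S (e^{Δ_{D′}}G))(X)‖ ≤ ((2p)!/(βL²))·(#legs·Σ_{m′ ≥ p} C(2m′,2p)γ^{2m′−2p}N_g(m′))` (`norm_vertexFn_map_hubbardGridSub_le_of_pinned` ∘ Literature
  `sum_norm_kernel_gaussConv_le_binomial_of_gramBounded`; `#legs = 4NL²`, so the prefactor is `4·(2p)!·N/β` — intensive with the grid vertex scale `β/N` inside `N_g`);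
* **`klmg_vertexFn_map_gaussConv_sub_le_binomial`** — DIFFERENCES (one level): `‖𝒱_{2p}(map S (e^{Δ_{D₁}}H))(X) − 𝒱_{2p}(map S H)(X)‖ ≤ ((2p)!/(βL²))·(#legs·Σ_{m′ > p}
  C(2m′,2p)γ₁^{2m′−2p}N_H(m′))` for `H` even with pinned norms `N_H` (Literature `sum_norm_kernel_gaussConv_sub_le_binomial_of_gramBounded`); and
  **`…_sub_le_binomial₂`** (two levels): `H := e^{Δ_{D′}}G`, `N_H := Σ_{m″ ≥ m′} C(2m″,2m′)γ^{2m″−2m′}N_g(m″)`;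
* **`klmg_isGramBoundedR_gridSub_softCovOf_of_mass_le`** — the Gram constant of `Sᵀ·softCovOf K φ·S` IS THE MASS: `(βL²)⁻¹·Σ_k |φ(k)|/ρ_K(k) ≤ κ²` ⟹
  `IsGramBoundedR (Sᵀ·softCovOf K φ·S) κ` on every grid `N` (`isGramBoundedR_hubbardGridSub_pullback_normalCovariance_of_mass_le`; k3c2-p1's
  `isGramBoundedR_gridSub_softSubCov_zero` is the case `0 ≤ φ ≤ 1 − w^K_{e₀}`, `κ² = 6047`) — mass-SENSITIVE for the `D`-line `s_{n,j} − s_{n,j′}` (`∝ klIdxMass`).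
Keyed member rows (M4 M6 M2 / η's) and the BASE row in this currency are the companion files.  Composition over landed lemmas; nothing about the model's sizes is asserted;
nothing asserts (X).3, (c), K3 or superconductivity.  0 kit · 0 lit.
-/

noncomputable section

namespace Summit.HubbardSuperconductivity.HubbardSuperconductivity.Theorems.KLRegimeSplit

set_option linter.dupNamespace false -- summit = problem name (single-conjunct summit), D-0017

open Finset Matrix Set Literature.MathematicalPhysics.QuantumLattice Literature.Probability.LatticeModels GrassmannAlgebra
open Summit.HubbardSuperconductivity.HubbardSuperconductivity.Theorems.KLProgrammeLegKernels
open Summit.HubbardSuperconductivity.HubbardSuperconductivity.Theorems.TwoPointAssembly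
open Summit.HubbardSuperconductivity.HubbardSuperconductivity.Theorems.DispersionFlow
open Summit.HubbardSuperconductivity.HubbardSuperconductivity.Theorems.KLRegimeWick
open Summit.HubbardSuperconductivity.HubbardSuperconductivity.Theorems.EngineV8

universe u

/-! ## §1 The continuum-slice action and its carriers are grid images -/

section GridImage

variable (L M : ℕ) [NeZero L] [NeZero M] (β U μ : ℝ) (K : TrigPolyC4v)

/-- **`𝒲^K_Λ` is a grid image at EVERY real cutoff** (`β ≠ 0`, grid `N = 4M`):
`hubbardEffectiveActionCT … K Λ = map S (effAction (SᵀC^K_{>Λ}S) (V_N + 𝒩_{K,N}))`. -/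
theorem klmg_effectiveActionCT_eq_map_grid (hβ : β ≠ 0) (Λ : ℝ) :
    hubbardEffectiveActionCT L M β U μ 0 K Λ =
      ExteriorAlgebra.map (Matrix.toLin' (hubbardGridSub L M β (2 * (2 * M))))
        (effAction ℂ ((hubbardGridSub L M β (2 * (2 * M))).transpose * hubbardCovAboveCT L M β μ 0 K Λ * hubbardGridSub L M β (2 * (2 * M)))
          (hubbardGridInteraction L (2 * (2 * M)) β U + hubbardGridCounterQuadratic L (2 * (2 * M)) β K)) := by
  haveI : NeZero (2 * (2 * M)) := ⟨by have := NeZero.ne M; omega⟩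
  rw [hubbardEffectiveActionCT_def, ← map_hubbardGridSub_gridInteractionCT (L := L) (M := M) (N := 2 * (2 * M)) hβ U K (by omega) (by omega),
    effAction_map, LinearMap.toMatrix'_toLin']

/-- **Every carrier is a grid image**: `e^{Δ_D}𝒲^K_Λ = map S (e^{Δ_{SᵀDS}}·effAction (SᵀC^K_{>Λ}S) (V_N + 𝒩_{K,N}))`. -/
theorem klmg_carrier_eq_map_grid (hβ : β ≠ 0) (D : Matrix (HubbardFieldIdx L M) (HubbardFieldIdx L M) ℂ) (Λ : ℝ) :
    gaussConv ℂ D (hubbardEffectiveActionCT L M β U μ 0 K Λ) =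
      ExteriorAlgebra.map (Matrix.toLin' (hubbardGridSub L M β (2 * (2 * M))))
        (gaussConv ℂ ((hubbardGridSub L M β (2 * (2 * M))).transpose * D * hubbardGridSub L M β (2 * (2 * M)))
          (effAction ℂ ((hubbardGridSub L M β (2 * (2 * M))).transpose * hubbardCovAboveCT L M β μ 0 K Λ * hubbardGridSub L M β (2 * (2 * M)))
            (hubbardGridInteraction L (2 * (2 * M)) β U + hubbardGridCounterQuadratic L (2 * (2 * M)) β K))) := by
  rw [klmg_effectiveActionCT_eq_map_grid L M β U μ K hβ Λ, gaussConv_map, LinearMap.toMatrix'_toLin']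

omit [NeZero M] in
/-- The grid effective action is even (any grid size, any grid covariance). -/
theorem klmg_gridAction_mem_evenPart {N : ℕ} (C' : Matrix (GridLeg (GridPoint L N)) (GridLeg (GridPoint L N)) ℂ) :
    effAction ℂ C' (hubbardGridInteraction L N β U + hubbardGridCounterQuadratic L N β K) ∈ evenPart ℂ (GridLeg (GridPoint L N)) :=
  effAction_mem_evenPart C' (add_mem (hubbardGridInteraction_mem_evenPart β U) (hubbardGridCounterQuadratic_mem_evenPart β K))
    (by rw [map_add, constPart_hubbardGridInteraction, constPart_hubbardGridCounterQuadratic, add_zero])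

end GridImage

/-! ## §2 Values of smeared grid functionals: one and two levels -/

section Values

/-- **Pinned kernel norms of `e^{Δ_D}H` in binomial–Gram form, any label type** (Literature `sum_norm_kernel_gaussConv_le_binomial_of_gramBounded` in an even degree
`2m`, condition read as `m ≤ m′`): `Σ_{Y : Y_i = w}‖kernel_{2m}(e^{Δ_D}H)(Y)‖ ≤ Σ_{m′} [m ≤ m′]·C(2m′,2m)·κ^{2m′−2m}·N(m′)`. -/
theorem klmg_sum_norm_kernel_gaussConv_le_binomial {Γ : Type u} [Fintype Γ] [DecidableEq Γ] {D : Matrix Γ Γ ℂ} {κ : ℝ} (hκ : 0 ≤ κ)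
    (hGB : IsGramBoundedR D κ) (H : GrassmannAlgebra ℂ Γ) (hH : H ∈ evenPart ℂ Γ) (N : ℕ → ℝ) (hN0 : ∀ m', 0 ≤ N m')
    (hN : ∀ m' (j : Fin (2 * m')) (w : Γ), ∑ Y ∈ univ.filter (fun Y : Fin (2 * m') → Γ => Y j = w), ‖kernel ℂ H (2 * m') Y‖ ≤ N m')
    (m : ℕ) (i : Fin (2 * m)) (w : Γ) :
    ∑ Y ∈ univ.filter (fun Y : Fin (2 * m) → Γ => Y i = w), ‖kernel ℂ (gaussConv ℂ D H) (2 * m) Y‖ ≤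
      ∑ m' ∈ range (Fintype.card Γ / 2 + 1), if m ≤ m' then ((2 * m').choose (2 * m) : ℝ) * κ ^ (2 * m' - 2 * m) * N m' else 0 := by
  refine (sum_norm_kernel_gaussConv_le_binomial_of_gramBounded (𝕜 := ℂ) D hκ hGB H hH N hN0 hN (r := 2 * m) i w).trans (le_of_eq ?_)
  refine sum_congr rfl fun m' _ => ?_
  by_cases h : m ≤ m'
  · rw [if_pos (by omega), if_pos h]
  · rw [if_neg (by omega), if_neg h]

variable (L M : ℕ) [NeZero L] [NeZero M] (β : ℝ)

/-- **`klmg_vertexFn_map_gaussConv_le_binomial`** — values of a smeared grid functional (`0 < p`): for `G` even on the grid `N` with pinned kernel norms `N_g` and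
`IsGramBoundedR D′ γ`, `‖𝒱_{2p}(map S (e^{Δ_{D′}}G))(X)‖ ≤ ((2p)!/(βL²))·(#legs·Σ_{m′} [p ≤ m′]·C(2m′,2p)·γ^{2m′−2p}·N_g(m′))`. -/
theorem klmg_vertexFn_map_gaussConv_le_binomial (hβ : 0 < β) (N : ℕ)
    {D' : Matrix (GridLeg (GridPoint L N)) (GridLeg (GridPoint L N)) ℂ} {γ : ℝ} (hγ : 0 ≤ γ) (hGB : IsGramBoundedR D' γ)
    (G : GrassmannAlgebra ℂ (GridLeg (GridPoint L N))) (hG : G ∈ evenPart ℂ (GridLeg (GridPoint L N))) (Ng : ℕ → ℝ) (hN0 : ∀ m', 0 ≤ Ng m')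
    (hN : ∀ m' (j : Fin (2 * m')) (w : GridLeg (GridPoint L N)),
      ∑ Y ∈ univ.filter (fun Y : Fin (2 * m') → GridLeg (GridPoint L N) => Y j = w), ‖kernel ℂ G (2 * m') Y‖ ≤ Ng m')
    {p : ℕ} (hp : 0 < p) (X : Fin (2 * p) → HubbardFieldIdx L M) :
    ‖vertexFn L M β (ExteriorAlgebra.map (Matrix.toLin' (hubbardGridSub L M β N)) (gaussConv ℂ D' G)) (2 * p) X‖ ≤
      ((2 * p).factorial : ℝ) / (β * (L : ℝ) ^ 2) * (Fintype.card (GridLeg (GridPoint L N)) *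
        ∑ m' ∈ range (Fintype.card (GridLeg (GridPoint L N)) / 2 + 1), if p ≤ m' then ((2 * m').choose (2 * p) : ℝ) * γ ^ (2 * m' - 2 * p) * Ng m' else 0) := by
  have h0 : 1 ≤ 2 * p := by omega
  exact norm_vertexFn_map_hubbardGridSub_le_of_pinned (M := M) hβ N (gaussConv ℂ D' G) h0 X fun w =>
    klmg_sum_norm_kernel_gaussConv_le_binomial hγ hGB G hG Ng hN0 hN p ⟨0, h0⟩ w

/-- **`klmg_vertexFn_map_gaussConv_sub_le_binomial`** — differences, ONE level (`0 < p`): for `H` even on the grid with pinned kernel norms `N_H` and `IsGramBoundedR D₁ γ₁`,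
`‖𝒱_{2p}(map S (e^{Δ_{D₁}}H))(X) − 𝒱_{2p}(map S H)(X)‖ ≤ ((2p)!/(βL²))·(#legs·Σ_{m′} [p < m′]·C(2m′,2p)·γ₁^{2m′−2p}·N_H(m′))`. -/
theorem klmg_vertexFn_map_gaussConv_sub_le_binomial (hβ : 0 < β) (N : ℕ)
    {D₁ : Matrix (GridLeg (GridPoint L N)) (GridLeg (GridPoint L N)) ℂ} {γ₁ : ℝ} (hγ₁ : 0 ≤ γ₁) (hGB₁ : IsGramBoundedR D₁ γ₁)
    (H : GrassmannAlgebra ℂ (GridLeg (GridPoint L N))) (hH : H ∈ evenPart ℂ (GridLeg (GridPoint L N))) (NH : ℕ → ℝ) (hNH0 : ∀ m', 0 ≤ NH m')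
    (hNH : ∀ m' (j : Fin (2 * m')) (w : GridLeg (GridPoint L N)),
      ∑ Y ∈ univ.filter (fun Y : Fin (2 * m') → GridLeg (GridPoint L N) => Y j = w), ‖kernel ℂ H (2 * m') Y‖ ≤ NH m')
    {p : ℕ} (hp : 0 < p) (X : Fin (2 * p) → HubbardFieldIdx L M) :
    ‖vertexFn L M β (ExteriorAlgebra.map (Matrix.toLin' (hubbardGridSub L M β N)) (gaussConv ℂ D₁ H)) (2 * p) X -
        vertexFn L M β (ExteriorAlgebra.map (Matrix.toLin' (hubbardGridSub L M β N)) H) (2 * p) X‖ ≤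
      ((2 * p).factorial : ℝ) / (β * (L : ℝ) ^ 2) * (Fintype.card (GridLeg (GridPoint L N)) *
        ∑ m' ∈ range (Fintype.card (GridLeg (GridPoint L N)) / 2 + 1), if p < m' then ((2 * m').choose (2 * p) : ℝ) * γ₁ ^ (2 * m' - 2 * p) * NH m' else 0) := by
  have h0 : 1 ≤ 2 * p := by omega
  rw [← klw_vertexFn_sub, ← map_sub]
  exact norm_vertexFn_map_hubbardGridSub_le_of_pinned (M := M) hβ N (gaussConv ℂ D₁ H - H) h0 X fun w =>
    sum_norm_kernel_gaussConv_sub_le_binomial_of_gramBounded (𝕜 := ℂ) D₁ hγ₁ hGB₁ H hH NH hNH0 hNH (p := p) ⟨0, h0⟩ w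

/-- **`klmg_vertexFn_map_gaussConv_sub_le_binomial₂`** — differences, TWO levels (`0 < p`): `H := e^{Δ_{D′}}G` with `G` even, pinned norms `N_g`, `IsGramBoundedR D′ γ`, and
`IsGramBoundedR D₁ γ₁`: `‖𝒱_{2p}(map S (e^{Δ_{D₁ + D′}}G))(X) − 𝒱_{2p}(map S (e^{Δ_{D′}}G))(X)‖ ≤ ((2p)!/(βL²))·(#legs·Σ_{m′} [p < m′]·C(2m′,2p)·γ₁^{2m′−2p}·N^car(m′))`,
`N^car(m′) = Σ_{m″} [m′ ≤ m″]·C(2m″,2m′)·γ^{2m″−2m′}·N_g(m″)`. -/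
theorem klmg_vertexFn_map_gaussConv_sub_le_binomial₂ (hβ : 0 < β) (N : ℕ)
    {D₁ D' : Matrix (GridLeg (GridPoint L N)) (GridLeg (GridPoint L N)) ℂ} {γ₁ γ : ℝ} (hγ₁ : 0 ≤ γ₁) (hGB₁ : IsGramBoundedR D₁ γ₁)
    (hγ : 0 ≤ γ) (hGB : IsGramBoundedR D' γ)
    (G : GrassmannAlgebra ℂ (GridLeg (GridPoint L N))) (hG : G ∈ evenPart ℂ (GridLeg (GridPoint L N))) (Ng : ℕ → ℝ) (hN0 : ∀ m', 0 ≤ Ng m')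
    (hN : ∀ m' (j : Fin (2 * m')) (w : GridLeg (GridPoint L N)),
      ∑ Y ∈ univ.filter (fun Y : Fin (2 * m') → GridLeg (GridPoint L N) => Y j = w), ‖kernel ℂ G (2 * m') Y‖ ≤ Ng m')
    {p : ℕ} (hp : 0 < p) (X : Fin (2 * p) → HubbardFieldIdx L M) :
    ‖vertexFn L M β (ExteriorAlgebra.map (Matrix.toLin' (hubbardGridSub L M β N)) (gaussConv ℂ (D₁ + D') G)) (2 * p) X -
        vertexFn L M β (ExteriorAlgebra.map (Matrix.toLin' (hubbardGridSub L M β N)) (gaussConv ℂ D' G)) (2 * p) X‖ ≤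
      ((2 * p).factorial : ℝ) / (β * (L : ℝ) ^ 2) * (Fintype.card (GridLeg (GridPoint L N)) *
        ∑ m' ∈ range (Fintype.card (GridLeg (GridPoint L N)) / 2 + 1), if p < m' then ((2 * m').choose (2 * p) : ℝ) * γ₁ ^ (2 * m' - 2 * p) *
          (∑ m'' ∈ range (Fintype.card (GridLeg (GridPoint L N)) / 2 + 1), if m' ≤ m'' then ((2 * m'').choose (2 * m') : ℝ) * γ ^ (2 * m'' - 2 * m') * Ng m'' else 0)
          else 0) := by
  rw [gaussConv_add_apply]
  exact klmg_vertexFn_map_gaussConv_sub_le_binomial L M β hβ N hγ₁ hGB₁ (gaussConv ℂ D' G) ((mem_evenPart_iff).2 (gaussConv_mem_evenOdd ℂ D' ((mem_evenPart_iff).1 hG)))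
    _ (fun m' => klmd_binomialProfile_nonneg hγ Ng hN0 _ m') (fun m' j w => klmg_sum_norm_kernel_gaussConv_le_binomial hγ hGB G hG Ng hN0 hN m' j w) hp X

end Values

/-! ## §3 The Gram constant of a pulled-back soft covariance is the mass of its symbol -/

section Gram

variable (L M : ℕ) [NeZero L] [NeZero M]

/-- `‖(iω + ξ)/(ω² + ξ²)‖ = 1/√(ω² + ξ²)` (also at `ω = ξ = 0`, where both sides vanish). -/
private theorem klmg_norm_I_mul_add_div (ω ξ : ℝ) :
    ‖(Complex.I * (ω : ℂ) + (ξ : ℂ)) / (((ω ^ 2 + ξ ^ 2 : ℝ)) : ℂ)‖ = 1 / Real.sqrt (ω ^ 2 + ξ ^ 2) := by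
  have hnum : ‖Complex.I * (ω : ℂ) + (ξ : ℂ)‖ = Real.sqrt (ω ^ 2 + ξ ^ 2) := by
    rw [Complex.norm_eq_sqrt_sq_add_sq]
    congr 1
    simp [Complex.add_re, Complex.add_im, Complex.mul_re, Complex.mul_im]
    ring
  rw [norm_div, hnum, Complex.norm_real, Real.norm_eq_abs, abs_of_nonneg (by positivity)]
  by_cases h0 : ω ^ 2 + ξ ^ 2 = 0
  · rw [h0, Real.sqrt_zero]; simp
  · have hpos : 0 < ω ^ 2 + ξ ^ 2 := lt_of_le_of_ne (by positivity) (Ne.symm h0)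
    rw [div_eq_div_iff (by positivity) (Real.sqrt_pos.2 hpos).ne', one_mul, Real.mul_self_sqrt hpos.le]

omit [NeZero M] in
/-- **`klmg_isGramBoundedR_gridSub_softCovOf_of_mass_le`** — the replica-Gram constant of the grid pullback of a soft covariance is the phase-space MASS of its symbol:
for any real symbol `φ`, any grid `N`, `0 < β`, `0 ≤ κ` and `(βL²)⁻¹·Σ_k |φ(k)|/√(ω_k² + e_K(k)²) ≤ κ²`, `IsGramBoundedR (Sᵀ·softCovOf K φ·S) κ`, `S = hubbardGridSub L M β N`
(`isGramBoundedR_hubbardGridSub_pullback_normalCovariance_of_mass_le`; zero seed: `nambuDen = ω² + e_K²`). -/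
theorem klmg_isGramBoundedR_gridSub_softCovOf_of_mass_le {β : ℝ} (hβ : 0 < β) (μ : ℝ) (K : TrigPolyC4v) (N : ℕ) (φ : FreqMomentum L M → ℝ)
    {κ : ℝ} (hκ : 0 ≤ κ)
    (hmass : 1 / (β * (L : ℝ) ^ 2) * ∑ k : FreqMomentum L M, |φ k| / Real.sqrt (matsubaraFreq β M k.1 ^ 2 + nambuXiCT L μ K k.2 ^ 2) ≤ κ ^ 2) :
    IsGramBoundedR ((hubbardGridSub L M β N).transpose * softCovOf L M β μ K φ * hubbardGridSub L M β N) κ := by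
  have hL : (0 : ℝ) < L := by exact_mod_cast Nat.pos_of_ne_zero (NeZero.ne L)
  have hβL2 : 0 < β * (L : ℝ) ^ 2 := by positivity
  rw [softCovOf, hubbardGridSub]
  refine isGramBoundedR_gridSub_pullback_normalCovariance_of_mass_le β _ _ _ hκ fun σ => ?_
  have hterm : ∀ k : FreqMomentum L M,
      ‖((1 / (β * (L : ℝ) ^ 2) : ℝ) : ℂ)‖ ^ 2 *
          ‖((φ (k, σ).1 : ℂ) * (((β * (L : ℝ) ^ 2 : ℝ) : ℂ) *
            ((Complex.I * matsubaraFreq β M (k, σ).1.1 + nambuXiCT L μ K (k, σ).1.2) / nambuDenCT L M β μ 0 K (k, σ).1)))‖ =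
        1 / (β * (L : ℝ) ^ 2) * (|φ k| / Real.sqrt (matsubaraFreq β M k.1 ^ 2 + nambuXiCT L μ K k.2 ^ 2)) := by
    intro k
    have hden : (nambuDenCT L M β μ 0 K k : ℝ) = matsubaraFreq β M k.1 ^ 2 + nambuXiCT L μ K k.2 ^ 2 := by rw [nambuDenCT_zero_seed]
    have hsym : ‖(Complex.I * (matsubaraFreq β M k.1 : ℂ) + (nambuXiCT L μ K k.2 : ℂ)) / ((nambuDenCT L M β μ 0 K k : ℝ) : ℂ)‖ =
        1 / Real.sqrt (matsubaraFreq β M k.1 ^ 2 + nambuXiCT L μ K k.2 ^ 2) := by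
      rw [hden]; exact klmg_norm_I_mul_add_div _ _
    have h1 : ‖((1 / (β * (L : ℝ) ^ 2) : ℝ) : ℂ)‖ = 1 / (β * (L : ℝ) ^ 2) := by
      rw [Complex.norm_real, Real.norm_eq_abs, abs_of_nonneg (by positivity)]
    have h2 : ‖(((β * (L : ℝ) ^ 2 : ℝ)) : ℂ)‖ = β * (L : ℝ) ^ 2 := by
      rw [Complex.norm_real, Real.norm_eq_abs, abs_of_nonneg (by positivity)]
    have h3 : ‖(φ k : ℂ)‖ = |φ k| := by rw [Complex.norm_real, Real.norm_eq_abs]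
    simp only []
    rw [norm_mul, norm_mul, h1, h2, h3, hsym]
    field_simp
  rw [Fintype.sum_congr _ _ hterm, ← mul_sum]
  exact hmass

end Gram

end Summit.HubbardSuperconductivity.HubbardSuperconductivity.Theorems.KLRegimeSplit

end
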